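import Summits.CriticalPhenomena.CardyFormulaZ2.Theorems.CardySelfDualSegmentUniformMarginalityMixedApproximantsPart1
import Summits.CriticalPhenomena.CardyFormulaZ2.Theorems.CardySelfDualSegmentUniformMarginalityMixedApproximantsPart2

/-!
# Rectilinear inner and outer approximants with nested crude crossing events
(stub `stub_mixedApproximants` of the line `Sketch`, crux `UniformMarginality`)

Support file of the line `Sketch` for the crux `UniformMarginality` (stmt-CriticalPhenomena-5472,
route `CardySelfDualSegment`): the geometric half of the transport of the crux from rectilinear
to general conformal rectangles. For every conformal rectangle `R` and `ε₀ > 0` there are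
RECTILINEAR conformal rectangles `R'`, `R''` (frontier in a finite union of axis-parallel
segments), `ε₀`-close to `R` in boundary loop and marks IN THE PARAMETRISATION OF `R`, and a mesh
threshold `δ₀ > 0` such that for every mesh `0 < δ < δ₀` and EVERY lattice configuration
`ω ⊆ E(ℤ²)` the crude crossing events are nested:
`crossEvent R' δ ⊆ crossEvent R δ ⊆ crossEvent R'' δ` (`stub_mixedApproximants`).

The inner approximant is `exists_innerApproximant` (part 2). The OUTER one
(`exists_outerApproximant`): the upper comparison domain `U` of `R` (`exists_upperDomain`, part 1,
collar width `g/4` for the gap `g` of the arcs `0, 2`) with room `r`, then `R'' := P` rectilinear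
with the marks of `U` and a `min (ε/2) (r/2)`-close loop (`exists_rectilinear_close`), so
`U_{-r} ⊆ P` (leash containment, part 2) and `closure P ⊆ U_{+r}`, `P.arc i ⊆ (U.arc i)_{+r}`;
`(R, P)` is in the mixed position of `crossEvent_subset_of_mixed`
(`CardySelfDualSegmentUniformMarginalityCrudeSandwich.lean`) with the pockets
`F₀ = closure R ∖ P ∩ {infDist · arc₀ ≤ g/4}`, `F₂` likewise, `C₀ = P.arc 1 ∪ P.arc 2 ∪ P.arc 3`,
`C₂ = P.arc 0 ∪ P.arc 1 ∪ P.arc 3`.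
-/

noncomputable section

namespace Summit.CriticalPhenomena.CardyFormulaZ2.Cruxes.UniformMarginality.HeatFlow

open Set Metric
open Literature.Probability.Percolation Literature.Probability.LatticeModels
  Literature.Probability.RandomPlanarGeometry
open Summit.CriticalPhenomena.CardyFormulaZ2.Theorems
open Summit.CriticalPhenomena.CardyFormulaZ2.Theorems.RectilinearApproximation
  (carrier_subset_cthickening_of_dist_boundary_le arc_subset_cthickening_of_dist_boundary_le)

namespace MixedApprox

/-- **The outer rectilinear approximant.** For `ε > 0` a rectilinear conformal rectangle `R''`,
`ε`-close to `R` in boundary loop and marks, whose crude crossing event contains that of `R` for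
all small meshes and all lattice configurations (upper comparison domain `exists_upperDomain`,
rectilinear approximation with the same marks, leash containment, mixed position,
`crossEvent_subset_of_mixed`). -/
theorem exists_outerApproximant : ∀ (R : ConformalRectangle) (ε : ℝ), 0 < ε →
    ∃ R'' : ConformalRectangle,
      (∃ S : Finset (ℂ × ℂ), (∀ p ∈ S, p.1.re = p.2.re ∨ p.1.im = p.2.im) ∧
        frontier R''.carrier ⊆ ⋃ p ∈ S, segment ℝ p.1 p.2) ∧
      (∀ u : ℝ, dist (R''.boundary u) (R.boundary u) ≤ ε) ∧ (∀ i : Fin 4, |R''.mark i - R.mark i| ≤ ε) ∧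
      ∃ δ₀ > 0, ∀ δ : ℝ, 0 < δ → δ < δ₀ → ∀ ω : BondConfig (Site 2), ω ⊆ (zdGraph 2).edgeSet →
        ω ∈ crossEvent R δ → ω ∈ crossEvent R'' δ := by
  intro R ε hε
  obtain ⟨g, hg, hgap⟩ := exists_pos_le_dist_arc_zero_arc_two R
  have hsum : ∀ z, g ≤ infDist z (R.arc 0) + infDist z (R.arc 2) :=
    le_infDist_add_infDist (R.isCompact_arc 0) (R.isCompact_arc 2) ⟨_, R.pt_mem_arc_self 0⟩
      ⟨_, R.pt_mem_arc_self 2⟩ hgap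
  obtain ⟨U, r, hr, hUb, hUm, hUA, hUB1, hUB3, hUC0, hUC2, hUD⟩ :=
    exists_upperDomain R (ε / 2) (g / 4) (by positivity) (by positivity)
  obtain ⟨P, hPm, hPS, hPb⟩ := exists_rectilinear_close U (ε := min (ε / 2) (r / 2))
    (lt_min (by positivity) (by positivity))
  have hρr : min (ε / 2) (r / 2) ≤ r / 2 := min_le_right _ _
  have hPU : closure P.carrier ⊆ cthickening r U.carrier :=
    closure_minimal ((carrier_subset_cthickening_of_dist_boundary_le U.toJordanDomain
      P.toJordanDomain hPb).trans (cthickening_mono (by linarith [hρr]) _)) isClosed_cthickening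
  have hParc : ∀ i, P.arc i ⊆ cthickening r (U.arc i) := fun i =>
    (arc_subset_cthickening_of_dist_boundary_le U P hPb hPm i).trans (cthickening_mono (by linarith [hρr]) _)
  have hUP : ∀ z ∈ U.carrier, (∀ w ∈ frontier U.carrier, r < dist z w) → z ∈ P.carrier :=
    fun z hz hroom => mem_carrier_of_forall_lt_dist U.toJordanDomain P.toJordanDomain hPb hz
      fun w hw => lt_of_le_of_lt (by linarith [hρr]) (hroom w hw)
  -- the pockets
  set F0 : Set ℂ := closure R.carrier ∩ P.carrierᶜ ∩ {z | infDist z (R.arc 0) ≤ g / 4} with hF0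
  set F2 : Set ℂ := closure R.carrier ∩ P.carrierᶜ ∩ {z | infDist z (R.arc 2) ≤ g / 4} with hF2
  have hKc : IsCompact (closure R.carrier ∩ P.carrierᶜ) :=
    R.isBounded.isCompact_closure.inter_right P.isOpen.isClosed_compl
  have hF0c : IsCompact F0 := hKc.inter_right (isClosed_le (continuous_infDist_pt _) continuous_const)
  have hF2c : IsCompact F2 := hKc.inter_right (isClosed_le (continuous_infDist_pt _) continuous_const)
  refine ⟨P, hPS, fun u => ?_, fun i => ?_, ?_⟩
  · calc dist (P.boundary u) (R.boundary u)
        ≤ dist (P.boundary u) (U.boundary u) + dist (U.boundary u) (R.boundary u) := dist_triangle _ _ _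
      _ ≤ min (ε / 2) (r / 2) + ε / 2 := add_le_add (hPb u) (hUb u)
      _ ≤ ε := by linarith [min_le_left (ε / 2) (r / 2)]
  · rw [hPm i]; exact (hUm i).trans (by linarith)
  refine crossEvent_subset_of_mixed R P F0 F2 (P.arc 1 ∪ P.arc 2 ∪ P.arc 3) (P.arc 0 ∪ P.arc 1 ∪ P.arc 3)
    hF0c hF2c (((P.isClosed_arc 1).union (P.isClosed_arc 2)).union (P.isClosed_arc 3))
    (((P.isClosed_arc 0).union (P.isClosed_arc 1)).union (P.isClosed_arc 3))
    ?_ ?_ ?_ ?_ ?_ ?_ ?_ ?_ ?_ ?_ ?_ ?_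
  · -- closure R ⊆ P ∪ F0 ∪ F2
    intro z hz
    by_cases hzP : z ∈ P.carrier
    · exact Or.inl (Or.inl hzP)
    by_cases h0 : infDist z (R.arc 0) ≤ g / 4
    · exact Or.inl (Or.inr ⟨⟨hz, hzP⟩, h0⟩)
    by_cases h2 : infDist z (R.arc 2) ≤ g / 4
    · exact Or.inr ⟨⟨hz, hzP⟩, h2⟩
    push Not at h0 h2
    obtain ⟨hzU, hroom⟩ := hUA z hz h0.le h2.le
    exact absurd (hUP z hzU hroom) hzP
  · exact Set.disjoint_left.2 fun z hz hzP => hz.1.2 hzP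
  · exact Set.disjoint_left.2 fun z hz hzP => hz.1.2 hzP
  · refine Set.disjoint_left.2 fun z hz hz' => ?_
    have a : infDist z (R.arc 0) ≤ g / 4 := hz.2
    have b : infDist z (R.arc 2) ≤ g / 4 := hz'.2
    linarith [hsum z]
  · intro z hz
    have := frontier_diff_arc_subset P 0 hz
    simp only [mem_iUnion, mem_setOf_eq, exists_prop] at this
    obtain ⟨j, hj, hzj⟩ := this
    fin_cases j
    · exact absurd rfl hj
    · exact Or.inl (Or.inl hzj)
    · exact Or.inl (Or.inr hzj)
    · exact Or.inr hzj
  · intro z hz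
    have := frontier_diff_arc_subset P 2 hz
    simp only [mem_iUnion, mem_setOf_eq, exists_prop] at this
    obtain ⟨j, hj, hzj⟩ := this
    fin_cases j
    · exact Or.inl (Or.inl hzj)
    · exact Or.inl (Or.inr hzj)
    · exact absurd rfl hj
    · exact Or.inr hzj
  · -- F0 off C0
    refine Set.disjoint_left.2 fun z hz hzC => ?_
    rcases hzC with (h1 | h2) | h3
    · exact hUB1 z (hParc 1 h1) hz.1.1
    · have := hUC2 z (hParc 2 h2)
      have a : infDist z (R.arc 0) ≤ g / 4 := hz.2
      linarith [hsum z]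
    · exact hUB3 z (hParc 3 h3) hz.1.1
  · refine Set.disjoint_left.2 fun z hz hzC => ?_
    rcases hzC with (h0 | h1) | h3
    · have := hUC0 z (hParc 0 h0)
      have a : infDist z (R.arc 2) ≤ g / 4 := hz.2
      linarith [hsum z]
    · exact hUB1 z (hParc 1 h1) hz.1.1
    · exact hUB3 z (hParc 3 h3) hz.1.1
  · exact Set.disjoint_left.2 fun z hz hzc => hUD z (hPU hzc) (Or.inl hz)
  · exact Set.disjoint_left.2 fun z hz hzc => hUD z (hPU hzc) (Or.inr hz)
  · refine Set.disjoint_left.2 fun z hz hz' => ?_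
    have := hsum z
    have b : infDist z (R.arc 2) ≤ g / 4 := hz'.2
    rw [infDist_zero_of_mem hz] at this
    linarith
  · refine Set.disjoint_left.2 fun z hz hz' => ?_
    have := hsum z
    have b : infDist z (R.arc 0) ≤ g / 4 := hz'.2
    rw [infDist_zero_of_mem hz] at this
    linarith

end MixedApprox

open Literature.Probability.Percolation Literature.Probability.LatticeModels
  Literature.Probability.RandomPlanarGeometry Metric

/-- **Stub `stub_mixedApproximants` of the line `Sketch`** (geometric half of the transport
kernel B₂a): for every conformal rectangle `R` and `ε₀ > 0` there are rectilinear conformal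
rectangles `R'`, `R''`, both `ε₀`-close to `R` in boundary loop and marks (in the parametrisation
of `R`), and `δ₀ > 0` such that for all meshes `0 < δ < δ₀` and all lattice configurations
`ω ⊆ E(ℤ²)`: `ω ∈ crossEvent R' δ → ω ∈ crossEvent R δ` and `ω ∈ crossEvent R δ → ω ∈ crossEvent R'' δ`
(`exists_innerApproximant`, `exists_outerApproximant`, `δ₀` the lesser threshold). -/
theorem stub_mixedApproximants :
    ∀ (R : ConformalRectangle) (ε₀ : ℝ), 0 < ε₀ →
      ∃ R' R'' : ConformalRectangle,
        (∃ S : Finset (ℂ × ℂ), (∀ p ∈ S, p.1.re = p.2.re ∨ p.1.im = p.2.im) ∧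
          frontier R'.carrier ⊆ ⋃ p ∈ S, segment ℝ p.1 p.2) ∧
        (∃ S : Finset (ℂ × ℂ), (∀ p ∈ S, p.1.re = p.2.re ∨ p.1.im = p.2.im) ∧
          frontier R''.carrier ⊆ ⋃ p ∈ S, segment ℝ p.1 p.2) ∧
        (∀ u : ℝ, dist (R'.boundary u) (R.boundary u) ≤ ε₀) ∧ (∀ i : Fin 4, |R'.mark i - R.mark i| ≤ ε₀) ∧
        (∀ u : ℝ, dist (R''.boundary u) (R.boundary u) ≤ ε₀) ∧ (∀ i : Fin 4, |R''.mark i - R.mark i| ≤ ε₀) ∧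
        ∃ δ₀ > 0, ∀ δ : ℝ, 0 < δ → δ < δ₀ → ∀ ω : BondConfig (Site 2), ω ⊆ (zdGraph 2).edgeSet →
          (ω ∈ crossEvent R' δ → ω ∈ crossEvent R δ) ∧ (ω ∈ crossEvent R δ → ω ∈ crossEvent R'' δ) := by
  intro R ε₀ hε₀
  obtain ⟨R', hS', hb', hm', δ₁, hδ₁, h₁⟩ := MixedApprox.exists_innerApproximant R ε₀ hε₀
  obtain ⟨R'', hS'', hb'', hm'', δ₂, hδ₂, h₂⟩ := MixedApprox.exists_outerApproximant R ε₀ hε₀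
  refine ⟨R', R'', hS', hS'', hb', hm', hb'', hm'', min δ₁ δ₂, lt_min hδ₁ hδ₂, fun δ hδ hδlt ω hω => ?_⟩
  exact ⟨h₁ δ hδ (hδlt.trans_le (min_le_left _ _)) ω hω, h₂ δ hδ (hδlt.trans_le (min_le_right _ _)) ω hω⟩

end Summit.CriticalPhenomena.CardyFormulaZ2.Cruxes.UniformMarginality.HeatFlow

end
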